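import Mathlib
import Literature.Probability.RandomGraphs.LowDegree
import Literature.NumberTheory.Sieve.BourgainSarnakZieglerCriterionProofs
import Summits.QuantumAdvantage.QuantumAdvantage.Theses.MobiusLadder

/-!
# Sketch — crux-ideate stmt-QuantumAdvantage-1391 (QuadraticDigitPhases), ideator 1, round 1

First lemmas of the two idea cards `cut-rank-katai-linearisation` and
`carry-transfer-bounded-width`, stated over existing declarations. Nothing is proved here.
-/

set_option linter.dupNamespace false

namespace Summit.QuantumAdvantage.QuantumAdvantage.Cruxes.QuadraticDigitPhases.Ideator1

open Finset Literature.Probability.RandomGraphs.LowDegree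

/-- The digit vector of `N` on `n` binary places, as elements of `𝔽₂` (as in the crux). -/
def bitsVec (n N : ℕ) : Fin n → ZMod 2 := fun i => if Nat.testBit N i then 1 else 0

/-- The quadratic digital phase `(-1)^{P(bits_n N)}` (the crux's weight). -/
noncomputable def phase {n : ℕ} (P : MvPolynomial (Fin n) (ZMod 2)) (N : ℕ) : ℝ :=
  if MvPolynomial.eval (bitsVec n N) P = 1 then -1 else 1

/-- The CUT MATRIX of `P` at height `j`: the bipartite block of the quadratic part of `P`
coupling digit positions `< j` with positions `≥ j` (entry = coefficient of `x_i x_i'`),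
padded with zeros to an `n × n` matrix. Its rank is the cut-rank `r_P(j)`. -/
noncomputable def cutMatrix {n : ℕ} (j : ℕ) (P : MvPolynomial (Fin n) (ZMod 2)) :
    Matrix (Fin n) (Fin n) (ZMod 2) :=
  fun i i' => if (i : ℕ) < j ∧ j ≤ (i' : ℕ)
    then MvPolynomial.coeff (Finsupp.single i 1 + Finsupp.single i' 1) P else 0

/-- Walsh–dilation correlation over an interval: `Σ_{a ≤ T < b} w_A(bits(pT)) w_B(bits(qT))`
(masks `A, B` on the positions `< j`). This is the linear-approximation-table entry of the
S-function `T ↦ (pT, qT)` restricted to an interval. -/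
noncomputable def dilationCorr (p q j : ℕ) (A B : Finset (Fin j)) (a b : ℕ) : ℝ :=
  ∑ T ∈ Finset.Ico a b,
    walsh A (fun i : Fin j => Nat.testBit (p * T) i) * walsh B (fun i : Fin j => Nat.testBit (q * T) i)

/-- FIRST LEMMA of card `cut-rank-katai-linearisation` (the analytic input, "(3a)"):
Walsh–dilation decay. For distinct primes `p, q` (what BSZ needs; the natural hypothesis is
"distinct odd parts" — for `q = 2^k p` it is FALSE: `w_A(pT) w_{A+k}(2^k pT) = 1`) and
`δ > 0` there is `w` such that for every
height `j`, all masks with `|A ∪ B| ≥ w` and every interval `[a,b) ⊆ [0,2^j)`,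
`|Σ_{T∈[a,b)} w_A(pT) w_B(qT)| ≤ δ 2^j`. (Transfer operators on the joint carry chain
`(c_p, c_q) ∈ [0,p)×[0,q)`; numerically the worst case over ALL mask pairs decays like `0.87^w`.) -/
def DilationWalshDecay : Prop :=
  ∀ p q : ℕ, p.Prime → q.Prime → p ≠ q → ∀ δ : ℝ, 0 < δ → ∃ w : ℕ, ∀ j : ℕ, ∀ A B : Finset (Fin j),
    w ≤ (A ∪ B).card → ∀ a b : ℕ, b ≤ 2 ^ j → |dilationCorr p q j A B a b| ≤ δ * 2 ^ j

/-- The REDUCTION of card `cut-rank-katai-linearisation`: one cut of rank `≥ R` makes the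
Kátai pair sum of the quadratic digital phase small (Cauchy–Schwarz over the digits below the
cut + `DilationWalshDecay` + sparse-vector counting). `K` fixes how short `M` may be relative
to `2^n` (BSZ needs `M ≍ 2^n / e^{1/τ}`). -/
def HighCutRankKatai : Prop :=
  ∀ p q : ℕ, p.Prime → q.Prime → p ≠ q → ∀ τ : ℝ, 0 < τ → ∀ K : ℕ, ∃ R : ℕ,
    ∀ n j M : ℕ, ∀ P : MvPolynomial (Fin n) (ZMod 2), P.totalDegree ≤ 2 →
      R ≤ (cutMatrix j P).rank → M * max p q < 2 ^ n → 2 ^ n ≤ K * M →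
        |∑ m ∈ Finset.Icc 1 M, phase P (p * m) * phase P (q * m)| ≤ τ * M

/-- `DilationWalshDecay → HighCutRankKatai` is the first stub a crux-plan would register. -/
def HighCutRankKatai_of_decay : Prop := DilationWalshDecay → HighCutRankKatai

/-- TARGET of card `carry-transfer-bounded-width` (the complementary regime): quadratic
phases all of whose cuts have rank `< R` ("width `< R`": `(-1)^P` is computed by an
inhomogeneous `𝔽₂`-linear automaton with `2^{R+1}` states reading the digits upward) are
orthogonal to `λ`, uniformly, for every fixed `R`. -/
def LowCutRankLiouville : Prop :=
  ∀ R : ℕ, ∀ ε : ℝ, 0 < ε → ∀ᶠ n : ℕ in Filter.atTop, ∀ P : MvPolynomial (Fin n) (ZMod 2),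
    P.totalDegree ≤ 2 → (∀ j : ℕ, (cutMatrix j P).rank < R) →
      |∑ N ∈ Finset.range (2 ^ n), ((ArithmeticFunction.liouville N : ℤ) : ℝ) * phase P N|
        ≤ ε * (2 : ℝ) ^ n

/-- The quadratic coefficient matrix of `P` restricted to the ZONE of positions `[w, n - w)`
(entries outside the zone, and the diagonal, set to `0`); its rank is the "free-zone rank". -/
noncomputable def zoneQuadMatrix {n : ℕ} (w : ℕ) (P : MvPolynomial (Fin n) (ZMod 2)) :
    Matrix (Fin n) (Fin n) (ZMod 2) :=
  fun i i' => if w ≤ (i : ℕ) ∧ (i : ℕ) + w < n ∧ w ≤ (i' : ℕ) ∧ (i' : ℕ) + w < n ∧ i ≠ i'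
    then MvPolynomial.coeff (Finsupp.single i 1 + Finsupp.single i' 1) P else 0

/-- FIRST LEMMA of card `carry-transfer-bounded-width` ("(B4)"): Kátai decay for bounded-width
phases with enough RANK in the free zone. For width `< R` (all cut-ranks `< R`) and free-zone rank
`≥ r` the Kátai pair sums over LONG intervals of `m` are `≤ τ·length`. (Transfer operators on the joint
chain (c_p, c_q, s, s') ∈ [0,p)×[0,q)×𝔽₂^R×𝔽₂^R with an inhomogeneous finite alphabet of letters;
rank — not the number of active digits — is the right hypothesis: a "star" `x_a·L(x)` has rank 2 and
Kátai sum ≈ 0.25–0.57 however long `L` is, while k stars give ≈ 2^{-k}; numerics exp/stars.py.) -/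
def BoundedWidthKataiDecay : Prop :=
  ∀ p q : ℕ, p.Prime → q.Prime → p ≠ q → ∀ τ : ℝ, 0 < τ → ∀ K R : ℕ, ∃ w r : ℕ,
    ∀ n c d : ℕ, ∀ P : MvPolynomial (Fin n) (ZMod 2), P.totalDegree ≤ 2 →
      (∀ j : ℕ, (cutMatrix j P).rank < R) → r ≤ (zoneQuadMatrix w P).rank →
      c ≤ d → d * max p q < 2 ^ n → 2 ^ n ≤ K * (d - c) →
        |∑ m ∈ Finset.Ico c d, phase P (p * m) * phase P (q * m)| ≤ τ * (d - c)

/-- SECOND INPUT of card `carry-transfer-bounded-width` ("(B1)", a variant of the tree's PROVED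
`bourgainSarnakZiegler_criterion`): BSZ for `F` supported on an interval `I = [a,b)` with
`|I| ≥ N/K`, error proportional to `|I|`, Kátai hypothesis only on long intervals of `m`.
Finitary in `N` (thresholds uniform in `F`), as the n-dependent phases require. -/
def IntervalBSZ : Prop :=
  ∃ τ₀ : ℝ, 0 < τ₀ ∧ ∀ τ : ℝ, 0 < τ → τ ≤ τ₀ → ∀ K : ℕ, ∃ K₂ N₀ : ℕ, ∀ N : ℕ, N₀ ≤ N →
    ∀ (F : ℕ → ℂ) (ν : ArithmeticFunction ℂ), (∀ m, ‖F m‖ ≤ 1) → ν.IsMultiplicative →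
      (∀ m, ‖ν m‖ ≤ 1) → ∀ a b : ℕ, a ≤ b → b ≤ N → N ≤ K * (b - a) →
      (∀ m, m < a ∨ b ≤ m → F m = 0) →
      (∀ p₁ p₂ : ℕ, p₁.Prime → p₂.Prime → p₁ ≠ p₂ →
          (p₁ : ℝ) ≤ Real.exp (1 / τ) → (p₂ : ℝ) ≤ Real.exp (1 / τ) →
          ∀ c d : ℕ, c ≤ d → d * max p₁ p₂ ≤ N → N ≤ K₂ * (d - c) →
            ‖∑ m ∈ Finset.Ico c d, F (p₁ * m) * (starRingEnd ℂ) (F (p₂ * m))‖ ≤ τ * (d - c)) →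
      ‖∑ m ∈ Finset.Icc 1 N, ν m * F m‖ ≤ 2 * Real.sqrt (τ * Real.log (1 / τ)) * (b - a)

/-- The Lo-regime assembly a crux-plan would kernel-check (WalshLiouvilleBound = crux stmt-1390 of
the route, in print, enters through the Walsh expansion of the rank-`< r` pieces). -/
def LowCutRank_of : Prop :=
  IntervalBSZ → BoundedWidthKataiDecay →
    Summit.QuantumAdvantage.QuantumAdvantage.Theses.MobiusLadder.WalshLiouvilleBound →
      LowCutRankLiouville

/-- The dichotomy assembles the crux from the two regimes plus the tree's PROVED
Bourgain–Sarnak–Ziegler criterion (`bourgainSarnakZiegler_criterion_holds`, fixed-`N` form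
`BourgainSarnakZiegler.norm_sum_le_of_goodN`). Stated as the composition a crux-plan would
kernel-check. -/
def Dichotomy : Prop :=
  HighCutRankKatai → LowCutRankLiouville →
    Summit.QuantumAdvantage.QuantumAdvantage.Theses.MobiusLadder.QuadraticDigitPhases

-- sanity: the tree's BSZ fact is available by name
example : Literature.NumberTheory.Sieve.bourgainSarnakZiegler_criterion :=
  Literature.NumberTheory.Sieve.bourgainSarnakZiegler_criterion_holds

end Summit.QuantumAdvantage.QuantumAdvantage.Cruxes.QuadraticDigitPhases.Ideator1
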